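import Literature.MathematicalPhysics.QuantumLattice.VariationalEquilibriumTangentRealisation
import Literature.MathematicalPhysics.QuantumLattice.HubbardTTPrimeThermalPressureZeeman
import Literature.MathematicalPhysics.QuantumLattice.CanonicalVariationalPressure
import Literature.MathematicalPhysics.QuantumLattice.LayeredHubbardGrandCanonicalVariationalPressure
import HarnessLib

/-!
# Every filling is realised by a grand-canonical equilibrium state of the 2D `t–t'` Hubbard model in a Zeeman field, and the
# canonical pressure in a field IS the constrained variational pressure (with Griffiths magnetisation brackets for STATES)

Topic `MathematicalPhysics/QuantumLattice` (family `hubbard`; stage S2 (iii) `T > 0`, `T × H` axes of the phase map). The `t–t'` instance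
of `VariationalEquilibriumTangentRealisation` (Israel's tangent theorem along a coupling direction) through
`HubbardTTPrimeThermalPressureZeeman` (the number `pressureTT'Zeeman β t t' U n h`, its supporting chemical potential
`exists_chemicalPotential_gcPressureTT'Zeeman_eq`), `TIVariationalPressure` (`gcInteractionTT' t t' U μ h = Φ(t,t',U) − μn − h(n↑−n↓)` as a linear
family, `varPressure_gcInteractionTT'_eq : P_var = gcPressureTT'Zeeman`) and `CanonicalVariationalPressure` (`varPressureAt`). For
`β > 0`, `U ≥ 0`:

* `exists_isVarEquilibrium_gcInteractionTT'_density_eq_of_subgradient`: every subgradient `c` of `μ ↦ P(β;μ,h)` is `β·ρ(ω)` for an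
  equilibrium state at `(μ, h)`;
* **`exists_isVarEquilibrium_gcInteractionTT'_density_eq`**: for every filling `0 < n < 2` and field `h` there are `μ` with
  `P(μ,h) = pressureTT'Zeeman n h + βμn` and a variational equilibrium state at `(β; t,t',U; μ, h)` with density EXACTLY `n` (the state-level
  half of the equivalence of ensembles: the canonical ensemble in a field is realised by infinite-volume grand-canonical equilibria);
* **`varPressureAt_gcInteractionTT'_field_eq_pressureTT'Zeeman`**: `varPressureAt β (gcInteractionTT' t t' U 0 h) 1 n = pressureTT'Zeeman β t t' U n h`
  = `sup {s̄(ω) − β(e_Φ(ω) − h m(ω)) : ω TI, ρ(ω) = n}`, ATTAINED (`exists_entropyDensitySup_sub_mul_field_eq_pressureTT'Zeeman`);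
* `IsTranslationInvariant.spinImbalance_mem_Icc_of_near_pressureTT'Zeeman`: the MAGNETISATION BRACKETS FOR STATES — every TI state of
  filling `n` within `ε` of the supremum has `m(ω) ∈ [(p(n,h) − p(n,h−δ) − ε)/(βδ), (p(n,h+δ) − p(n,h) + ε)/(βδ)]` (certified canonical field
  pressures at three fields bracket the magnetisation of every near-equilibrium state of the canonical ensemble in a field).

HONEST SCOPE: existence/identification only; no uniqueness; no certificate value; no phase word; no definition. Everything PROVED, 0 sorry.

## Mathlib / tree search
REUSED: `exists_isVarEquilibrium_mul_meanEnergy_eq_of_subgradient` (sequel file), `gcInteractionTT'_update_mu`, `varPressure_gcInteractionTT'_eq`,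
`InfVolFermionState.meanEnergy_gcInteractionTT'_eq`, `meanEnergy_numberInteraction`, `IsTranslationInvariant.entropyDensitySup_sub_mul_le_gcPressureTT'Zeeman`,
`varPressureAt_le`, `sub_mul_le_varPressureAt`, `exists_chemicalPotential_gcPressureTT'Zeeman_eq`, `pressureTT'Zeeman_add_le_gcPressureTT'Zeeman`.

## References
* R. B. Israel, *Convexity in the Theory of Lattice Gases* (1979), Thm. I.2.4, §V.1. [cite: Israel1979, Thm. I.2.4]
* R. B. Griffiths, J. Math. Phys. 5 (1964) 1215, Appendix. [cite: Griffiths1964, Appendix]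
* D. Ruelle, *Statistical Mechanics: Rigorous Results* (1969), §3.4. [cite: Ruelle1969, §3.4]
-/

noncomputable section

namespace Literature.MathematicalPhysics.QuantumLattice

open _root_.Filter Set InfVolFermionState ThermodynamicLimit
open scoped _root_.Topology

/-- The field functional at `μ = 0` differs from the one at `μ` by `μρ(ω)`. [cite: Ruelle1969, §3.4] -/
private theorem meanEnergy_gc_zero_eq (ω : InfVolFermionState 2) (t t' U μ hz : ℝ) :
    ω.meanEnergy (gcInteractionTT' t t' U 0 hz) 1 = ω.meanEnergy (gcInteractionTT' t t' U μ hz) 1 + μ * ω.density := by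
  rw [ω.meanEnergy_gcInteractionTT'_eq, ω.meanEnergy_gcInteractionTT'_eq, meanEnergy_numberInteraction]; ring

section Hubbard

variable {β : ℝ} (hβ : 0 < β) (t t' : ℝ) {U : ℝ} (hU : 0 ≤ U)
include hβ hU

/-- **Every subgradient of `μ ↦ P(β;μ,h)` is `β·ρ(ω)` for an equilibrium state** of the grand-canonical `t–t'` model at `(μ,h)`.
[cite: Israel1979, Thm. I.2.4] -/
theorem exists_isVarEquilibrium_gcInteractionTT'_density_eq_of_subgradient (μ hz : ℝ) {c : ℝ}
    (hc : ∀ μ' : ℝ, gcPressureTT'Zeeman β t t' U μ hz + c * (μ' - μ) ≤ gcPressureTT'Zeeman β t t' U μ' hz) :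
    ∃ ω : InfVolFermionState 2, ω.IsVarEquilibrium β (gcInteractionTT' t t' U μ hz) 1 ∧ β * ω.density = c := by
  have hg : ∀ δ : ℝ, (FermionInteraction.linearFamily (hubbardTTPrimeFermionInteraction t t' U)
      ![numberInteraction 2, spinImbalanceInteraction 2] ![-μ, -hz]).varPressure β 1 + (-c) * δ ≤
      (FermionInteraction.linearFamily (hubbardTTPrimeFermionInteraction t t' U) ![numberInteraction 2, spinImbalanceInteraction 2]
        (![-μ, -hz] + Pi.single 0 δ)).varPressure β 1 := by
    intro δ
    rw [gcInteractionTT'_update_mu, show FermionInteraction.linearFamily (hubbardTTPrimeFermionInteraction t t' U)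
      ![numberInteraction 2, spinImbalanceInteraction 2] ![-μ, -hz] = gcInteractionTT' t t' U μ hz from rfl,
      varPressure_gcInteractionTT'_eq hβ.le t t' hU, varPressure_gcInteractionTT'_eq hβ.le t t' hU]
    have h := hc (μ - δ)
    linarith
  obtain ⟨ω, hω, he⟩ := exists_isVarEquilibrium_mul_meanEnergy_eq_of_subgradient (by norm_num : 0 < 2) β
    (hubbardTTPrimeFermionInteraction t t' U) ![numberInteraction 2, spinImbalanceInteraction 2] 1 ![-μ, -hz] 0 hg
  refine ⟨ω, hω, ?_⟩
  simp only [Matrix.cons_val_zero, neg_neg] at he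
  rwa [meanEnergy_numberInteraction] at he

/-- **EVERY FILLING IS REALISED BY A GRAND-CANONICAL EQUILIBRIUM STATE** (`β > 0`, `U ≥ 0`, `0 < n < 2`, every field `h`): there are a
chemical potential `μ` with `P(μ,h) = pressureTT'Zeeman β t t' U n h + βμn` and a variational equilibrium state `ω` at `(β; t,t',U; μ,h)`
with density EXACTLY `n`. [cite: Israel1979, Thm. I.2.4] -/
theorem exists_isVarEquilibrium_gcInteractionTT'_density_eq {n : ℝ} (hn0 : 0 < n) (hn2 : n < 2) (hz : ℝ) :
    ∃ μ : ℝ, gcPressureTT'Zeeman β t t' U μ hz = pressureTT'Zeeman β t t' U n hz + β * μ * n ∧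
      ∃ ω : InfVolFermionState 2, ω.IsVarEquilibrium β (gcInteractionTT' t t' U μ hz) 1 ∧ ω.density = n := by
  obtain ⟨μ, hμ⟩ := exists_chemicalPotential_gcPressureTT'Zeeman_eq t t' hU hβ hz hn0 hn2
  have hc : ∀ μ' : ℝ, gcPressureTT'Zeeman β t t' U μ hz + β * n * (μ' - μ) ≤ gcPressureTT'Zeeman β t t' U μ' hz := by
    intro μ'
    have h := pressureTT'Zeeman_add_le_gcPressureTT'Zeeman hβ.le t t' hU μ' hz hn0.le hn2
    rw [hμ]
    linarith [h]
  obtain ⟨ω, hω, hρ⟩ := exists_isVarEquilibrium_gcInteractionTT'_density_eq_of_subgradient hβ t t' hU μ hz hc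
  refine ⟨μ, hμ, ω, hω, ?_⟩
  have : β * ω.density = β * n := by rw [hρ]
  exact mul_left_cancel₀ hβ.ne' this

/-- **Upper half**: every TI state of filling `n` has `s̄(ω) − β(e_Φ(ω) − h m(ω)) ≤ pressureTT'Zeeman β t t' U n h` (`0 < n < 2`).
[cite: Israel1979, Thm. I.2.4] -/
theorem IsTranslationInvariant.entropyDensitySup_sub_mul_field_le_pressureTT'Zeeman {n : ℝ} (hn0 : 0 < n) (hn2 : n < 2) (hz : ℝ)
    {ω : InfVolFermionState 2} (hω : ω.IsTranslationInvariant) (hρ : ω.density = n) :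
    ω.entropyDensitySup - β * ω.meanEnergy (gcInteractionTT' t t' U 0 hz) 1 ≤ pressureTT'Zeeman β t t' U n hz := by
  obtain ⟨μ, hμ⟩ := exists_chemicalPotential_gcPressureTT'Zeeman_eq t t' hU hβ hz hn0 hn2
  have h := hω.entropyDensitySup_sub_mul_le_gcPressureTT'Zeeman hβ.le t t' hU μ hz
  rw [meanEnergy_gc_zero_eq ω t t' U μ hz, hρ]
  rw [hμ] at h
  linarith

/-- **THE CANONICAL PRESSURE IN A FIELD IS THE CONSTRAINED VARIATIONAL PRESSURE**:
`varPressureAt β (gcInteractionTT' t t' U 0 h) 1 n = pressureTT'Zeeman β t t' U n h = sup {s̄(ω) − β(e_Φ(ω) − h·m(ω)) : ω TI, ρ(ω) = n}`,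
attained by the grand-canonical equilibrium state of the realised filling (`β > 0`, `U ≥ 0`, `0 < n < 2`). [cite: Israel1979, Thm. I.2.4] -/
theorem varPressureAt_gcInteractionTT'_field_eq_pressureTT'Zeeman {n : ℝ} (hn0 : 0 < n) (hn2 : n < 2) (hz : ℝ) :
    (gcInteractionTT' t t' U 0 hz).varPressureAt β 1 n = pressureTT'Zeeman β t t' U n hz := by
  obtain ⟨μ, hμ, ω, hω, hρ⟩ := exists_isVarEquilibrium_gcInteractionTT'_density_eq hβ t t' hU hn0 hn2 hz
  refine le_antisymm ?_ ?_
  · exact (gcInteractionTT' t t' U 0 hz).varPressureAt_le β 1 n ⟨ω, hω.1, hρ⟩ fun ν hν hνρ =>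
      IsTranslationInvariant.entropyDensitySup_sub_mul_field_le_pressureTT'Zeeman hβ t t' hU hn0 hn2 hz hν hνρ
  · have h := (gcInteractionTT' t t' U 0 hz).sub_mul_le_varPressureAt β 1 n hω.1 hρ
    have heq := hω.2
    rw [varPressure_gcInteractionTT'_eq hβ.le t t' hU, hμ] at heq
    rw [meanEnergy_gc_zero_eq ω t t' U μ hz, hρ] at h
    linarith

/-- **The supremum is ATTAINED by an equilibrium state of filling `n`**: `s̄(ω) − β(e_Φ(ω) − h m(ω)) = pressureTT'Zeeman β t t' U n h` for some
TI `ω` with `ρ(ω) = n` which is a grand-canonical equilibrium at the supporting `μ`. [cite: Israel1979, Thm. I.2.4] -/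
theorem exists_entropyDensitySup_sub_mul_field_eq_pressureTT'Zeeman {n : ℝ} (hn0 : 0 < n) (hn2 : n < 2) (hz : ℝ) :
    ∃ ω : InfVolFermionState 2, ω.IsTranslationInvariant ∧ ω.density = n ∧
      ω.entropyDensitySup - β * ω.meanEnergy (gcInteractionTT' t t' U 0 hz) 1 = pressureTT'Zeeman β t t' U n hz := by
  obtain ⟨μ, hμ, ω, hω, hρ⟩ := exists_isVarEquilibrium_gcInteractionTT'_density_eq hβ t t' hU hn0 hn2 hz
  refine ⟨ω, hω.1, hρ, ?_⟩
  have heq := hω.2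
  rw [varPressure_gcInteractionTT'_eq hβ.le t t' hU, hμ] at heq
  rw [meanEnergy_gc_zero_eq ω t t' U μ hz, hρ]
  linarith

/-- **Magnetisation brackets for STATES** (Griffiths in the field at fixed filling): every TI state of filling `n` within `ε` of the canonical
field pressure, `pressureTT'Zeeman n h − ε ≤ s̄(ω) − β(e_Φ(ω) − h m(ω))`, has
`(p(n,h) − p(n,h−δ) − ε)/(βδ) ≤ m(ω) ≤ (p(n,h+δ) − p(n,h) + ε)/(βδ)` for every `δ > 0` (`m(ω)` = mean energy of `spinImbalanceInteraction`).
[cite: Griffiths1964, Appendix] -/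
theorem IsTranslationInvariant.spinImbalance_mem_Icc_of_near_pressureTT'Zeeman {n : ℝ} (hn0 : 0 < n) (hn2 : n < 2) (hz : ℝ)
    {ω : InfVolFermionState 2} (hω : ω.IsTranslationInvariant) (hρ : ω.density = n) {ε δ : ℝ} (hδ : 0 < δ)
    (hnear : pressureTT'Zeeman β t t' U n hz - ε ≤ ω.entropyDensitySup - β * ω.meanEnergy (gcInteractionTT' t t' U 0 hz) 1) :
    ω.meanEnergy (spinImbalanceInteraction 2) 1 ∈ Set.Icc
      ((pressureTT'Zeeman β t t' U n hz - pressureTT'Zeeman β t t' U n (hz - δ) - ε) / (β * δ))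
      ((pressureTT'Zeeman β t t' U n (hz + δ) - pressureTT'Zeeman β t t' U n hz + ε) / (β * δ)) := by
  have hup := IsTranslationInvariant.entropyDensitySup_sub_mul_field_le_pressureTT'Zeeman hβ t t' hU hn0 hn2 (hz + δ) hω hρ
  have hdn := IsTranslationInvariant.entropyDensitySup_sub_mul_field_le_pressureTT'Zeeman hβ t t' hU hn0 hn2 (hz - δ) hω hρ
  have e1 : ω.meanEnergy (gcInteractionTT' t t' U 0 (hz + δ)) 1 =
      ω.meanEnergy (gcInteractionTT' t t' U 0 hz) 1 - δ * ω.meanEnergy (spinImbalanceInteraction 2) 1 := by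
    rw [ω.meanEnergy_gcInteractionTT'_eq, ω.meanEnergy_gcInteractionTT'_eq]; ring
  have e2 : ω.meanEnergy (gcInteractionTT' t t' U 0 (hz - δ)) 1 =
      ω.meanEnergy (gcInteractionTT' t t' U 0 hz) 1 + δ * ω.meanEnergy (spinImbalanceInteraction 2) 1 := by
    rw [ω.meanEnergy_gcInteractionTT'_eq, ω.meanEnergy_gcInteractionTT'_eq]; ring
  rw [e1] at hup
  rw [e2] at hdn
  have hβδ : 0 < β * δ := mul_pos hβ hδ
  constructor
  · rw [div_le_iff₀ hβδ]; linarith [hdn, hnear]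
  · rw [le_div_iff₀ hβδ]; linarith [hup, hnear]

end Hubbard

end Literature.MathematicalPhysics.QuantumLattice
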